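import Summits.BirchSwinnertonDyer.BirchSwinnertonDyer.Theorems.ClassRecordThreeCornerAtThreeTwinLowerSupplyDefs
import Summits.BirchSwinnertonDyer.Rank1Residual.Additive.QuadraticTwistSurj
import Summits.BirchSwinnertonDyer.Rank1Residual.X11a.Cells
import HarnessLib

/-!
# Route `ErratumRoadFive` (rung K2), crux `NonSurjCorner` (item stmt-BirchSwinnertonDyer-19065), registered line `Lines/hybrid.lean`:
# THE TWIN-LOWER SUPPLY OF A (T4′) CORNER PAIR FROM THE X11a LOWER HALF AT NON-SURJECTIVE CURVES ONLY
# (cell `bsd-stepL`, seat `bsd-stepL-corner-p1` g16; `--supports stmt-BirchSwinnertonDyer-19065 --as helper`; RULING 48 re-glue)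

WHY THIS FILE. The hybrid line for crux 19065 (`Cruxes/NonSurjCorner/Lines/hybrid.lean` r5, glue #7 of this seat g14) consumes the rank-0
sister class's lower half `X11aLowerHalf` (item 19064, rung K6) WHOLE — slot 4 `stub_lowerX11a57` — although every twist it is ever applied to
is a quadratic twist `E^{(d_K)}` of a corner curve `E` with `ρ̄_{E,p}` NOT surjective, and surjectivity of `ρ̄_{·,p}` is invariant under quadratic
twist (`E^{(d)}[p] ≅ E[p] ⊗ χ_d`: the tree's `Rank1Residual.Additive.surj_iff_of_model_twist`, b2b). Planner g39's RULING 48 asked for the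
narrowing of slot 4 to 19064's NON-surjective sub-leaf — registered on 19064's own line as `stub_lowerNonSurjDeep`
(`∀ Wd p, ClassX11a Wd p → ¬ Surj Wd p → ¬ X11a.ShaAnUnit Wd p → MissingLowerBoundAt Wd p`, `Cruxes/X11aLowerHalf/Lines/birth.lean`) —
and this seat g15 recorded the re-glue as OWED (the §2 Shimura roads of the line carried the un-narrowed binder `hX11a` through four layers).
Lane B corner3-p2 g6 has already isolated exactly what those roads consume: the per-pair TWIN-LOWER SUPPLY `Theorems.FHTwinLowerSupplyAt W p`
(module `…CornerAtThreeTwinLowerSupplyDefs`, p-generic), derived there from Friedberg–Hoffstein's inert supply ∧ `X11aLowerHalf` at `p`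
(`fhTwinLowerSupplyAt_of_friedbergHoffstein_of_x11aLowerHalf`). THIS FILE derives the same supply from Friedberg–Hoffstein ∧ the X11a lower
half AT NON-SURJECTIVE CURVES ONLY, on a pair with `¬ Surj W p`:
* `fhTwinLowerSupplyAt_of_friedbergHoffstein_of_lowerNonSurj` — lane B's proof VERBATIM plus one line: the twist `Wd = Cd • E^{(d_K)}` has
  `¬ Surj Wd p` (`Additive.surj_iff_of_model_twist`);
* `fhTwinLowerSupplyAt_of_friedbergHoffstein_of_lowerNonSurjDeep` — the same from 19064's registered `stub_lowerNonSurjDeep` SHAPE (the lower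
  half is trivial at a curve whose `#Ш_an` is a `p`-adic unit: `lowerNonSurj_of_lowerNonSurjDeep`, pure logic);
* `NonSurjCorner.fhTwinLowerSupplyAt_of_lowerNonSurjDeep` — the class-level corner form (binders of crux 19065).
Consumers: this seat g16's supply-keyed corner roads (`…EulerHalfCornerOfTwinLower`) and glue #8 (`…HybridTwinLowerSupply`).

HONEST FRAMING: THEOREMS ONLY (no definition, no named fact, no `sorry`); CONDITIONAL on every displayed binder (`hGZK`, `hmod`, `hnf`,
Friedberg–Hoffstein's `hFH`, and the OPEN X11a lower half at non-surjective curves — 19064's `stub_lowerNonSurjDeep`, rung K6); nothing is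
discharged; 19065 ∕ 19064 stay OPEN; nothing about any curve's BSD; BSD is not advanced; T7. Credit: lane B corner3-p2 g6 (the supply and
its derivation, copied here with one extra line), b2b (`surj_iff_of_model_twist`).
References (locators only): [cite: FriedbergHoffstein1995, Thm. B] [cite: SilvermanAEC2009, X.5 Cor. 5.4 (twist of the mod-p representation)]
[cite: Skinner2016PacificMC, Thm. C (display shape)] [cite: Miller2011LMS, Def. 1.1].
-/

noncomputable section

open scoped Classical

open WeierstrassCurve NumberField IsDedekindDomain Literature.NumberTheory.EllipticCurves
  Rat.HeightOneSpectrum CongruenceSubgroup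
  Literature.NumberTheory.EllipticCurves.ModularForms
  Literature.NumberTheory.EllipticCurves.Rank1Residual
  Literature.NumberTheory.EllipticCurves.Rank1Residual.Typed
  Literature.NumberTheory.QuadraticFields.Quadratic
  Literature.NumberTheory.EllipticCurves.BarriosEtAl2025
  Literature.NumberTheory.Automorphic
  Summit.BirchSwinnertonDyer.Rank1Residual
  Summit.BirchSwinnertonDyer.Rank1Residual.X11b

-- the cell's Theorems namespace repeats the summit name (Summit.<Summit>.<Problem>), as in every sibling file
set_option linter.dupNamespace false

namespace Summit.BirchSwinnertonDyer.BirchSwinnertonDyer.Theorems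

/-! ### §1. Pure logic: 19064's `stub_lowerNonSurjDeep` shape gives the lower half at every non-surjective X11a curve -/

/-- At a curve whose analytic `Ш` is a rational `p`-adic unit the lower half `ord_p #Ш_an ≤ ord_p #Ш` is `0 ≤ ord_p #Ш` — so the
X11a lower half at non-surjective curves follows from its restriction to the NON-unit («deep») ones, i.e. from the SHAPE of 19064's
registered `stub_lowerNonSurjDeep`. Pure logic; any prime. [cite: Miller2011LMS, Def. 1.1 (arXiv:1010.2431 p. 3)] -/
theorem lowerNonSurj_of_lowerNonSurjDeep {p : ℕ} [Fact p.Prime]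
    (h : ∀ (Wd : WeierstrassCurve ℚ) [Wd.IsElliptic] [Wd.IsGloballyMinimal],
      ClassX11a Wd p → ¬ Surj Wd p → ¬ X11a.ShaAnUnit Wd p → Typed.MissingLowerBoundAt Wd p)
    (Wd : WeierstrassCurve ℚ) [Wd.IsElliptic] [Wd.IsGloballyMinimal]
    (hXa : ClassX11a Wd p) (hnsd : ¬ Surj Wd p) : Typed.MissingLowerBoundAt Wd p := by
  by_cases hu : X11a.ShaAnUnit Wd p
  · obtain ⟨q, hq, hv⟩ := hu
    exact ⟨q, hq, by rw [hv]; exact_mod_cast Nat.zero_le _⟩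
  · exact h Wd hXa hnsd hu

/-! ### §2. The twin-lower supply from Friedberg–Hoffstein and the X11a lower half at NON-SURJECTIVE curves -/

/-- **`FHTwinLowerSupplyAt W p` ⟸ Friedberg–Hoffstein's inert supply ∧ the X11a lower half at NON-SURJECTIVE curves, on an X11b pair with no
(ram) prime and `ρ̄_{E,p}` NOT surjective.** Lane B's `fhTwinLowerSupplyAt_of_friedbergHoffstein_of_x11aLowerHalf` VERBATIM (the Friedberg–Hoffstein
field with `T` inert, the other bad primes split, `|d_K| > 4`, `L(E^{d_K},1) ≠ 0`; a global minimal model `Wd` of the twist; `Wd` is a rank-`0`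
X11a pair at `p`), plus ONE line: `¬ Surj Wd p`, because `Wd = Cd • E^{(d_K)}` and surjectivity of the mod-`p` representation is a twist
invariant (`Additive.surj_iff_of_model_twist`). So the binder `hX11a` is needed only at curves with NON-surjective `ρ̄_{·,p}`.
Bookkeeping; CONDITIONAL on `hGZK`, `hmod`, `hnf`, `hFH`, `hX11a`.
-- adapted from Summits/BirchSwinnertonDyer/BirchSwinnertonDyer/Theorems/ClassRecordThreeCornerAtThreeTwinLowerSupplyDefs.lean
[cite: FriedbergHoffstein1995, Thm. B] [cite: SilvermanAEC2009, X.5 Cor. 5.4] [cite: Skinner2016PacificMC, Thm. C (shape)] [cite: Miller2011LMS, Def. 1.1] -/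
theorem fhTwinLowerSupplyAt_of_friedbergHoffstein_of_lowerNonSurj
    (hGZK : rank_eq_analyticRank_of_analyticRank_le_one) (hmod : hasEntireLFunction_rat)
    (hnf : exists_isNewformOf)
    (hFH : friedbergHoffstein_exists_twist_ne_zero_inertAt)
    (W : WeierstrassCurve ℚ) [W.IsElliptic] [W.IsGloballyMinimal] (p : ℕ) [Fact p.Prime]
    (hX : ClassX11b W p) (hns : ¬ Surj W p) (hnram : ¬ Ram W p)
    (hX11a : ∀ (Wd : WeierstrassCurve ℚ) [Wd.IsElliptic] [Wd.IsGloballyMinimal],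
      ClassX11a Wd p → ¬ Surj Wd p → Typed.MissingLowerBoundAt Wd p) :
    FHTwinLowerSupplyAt W p := by
  intro T hTmult hTeven
  have hp : p.Prime := Fact.out
  obtain ⟨hr, hp2, hmult, hirr⟩ := id hX
  -- the sign of the functional equation is `−1` (modularity, `r_an = 1`)
  have hw : W.rootNumber = -1 := by
    rw [WeierstrassCurve.rootNumber_eq_neg_one_pow_analyticRank_of_exists_isNewformOf hnf W, hr]
    norm_num
  -- the Friedberg–Hoffstein field, `T` inert, every other bad prime split, `|d_K| > 4`
  obtain ⟨K, _, _, hK, hdisc, hinert, hsplitN, hLt⟩ := hFH W hw T hTmult hTeven 4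
  have h2 := hK.1
  have hTin : ∀ ℓ ∈ T, ∃ _ : Fact ℓ.Prime, Mult W ℓ ∧
      ((ℓ ≠ 2 ∧ jacobiSym (NumberField.discr K) ℓ = -1) ∨ (ℓ = 2 ∧ NumberField.discr K % 8 = 5)) := by
    intro ℓ hℓ
    obtain ⟨hℓF, hm⟩ := hTmult ℓ hℓ
    obtain ⟨hn, hd⟩ := hinert ℓ hℓ
    refine ⟨hℓF, hm, ?_⟩
    have hn' : ((Ideal.span {(ℓ : ℤ)}).primesOver (𝓞 K)).ncard ≠ 2 := by rw [hn]; decide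
    by_cases hℓ2 : ℓ = 2
    · subst hℓ2
      have hn2 : ((Ideal.span {(2 : ℤ)}).primesOver (𝓞 K)).ncard ≠ 2 := by
        simpa only [Nat.cast_ofNat] using hn'
      have hd2 : ¬ (2 : ℤ) ∣ NumberField.discr K := by simpa only [Nat.cast_ofNat] using hd
      exact Or.inr ⟨rfl, discr_emod_eight_eq_five_of_ncard_ne_two h2 hn2 hd2⟩
    · exact Or.inl ⟨hℓ2, jacobiSym_discr_eq_neg_one_of_ncard_ne_two h2 hℓF.out hℓ2 hn' hd⟩
  have hsplit : ∀ (ℓ : ℕ) [Fact ℓ.Prime], ¬ W.HasGoodReductionAtPrime ℓ → ℓ ∉ T →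
      IsSquare (algebraMap ℚ ℚ_[ℓ] (NumberField.discr K : ℚ)) := by
    intro ℓ hℓF hg hℓT
    have hℓN : ℓ ∣ W.conductorNorm ℤ := (W.dvd_conductorNorm_iff_not_hasGoodReductionAtPrime ℓ).mpr hg
    exact isSquare_discr_padic_of_ncard_eq_two h2 ℓ (hsplitN ℓ hℓF.out hℓN hℓT)
  -- a globally minimal model of the twist
  have hD0 : (NumberField.discr K : ℚ) ≠ 0 := by exact_mod_cast NumberField.discr_ne_zero K
  haveI hEt : (W.quadraticTwist (NumberField.discr K : ℚ)).IsElliptic :=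
    W.isElliptic_quadraticTwist hD0
  obtain ⟨Cd, hCd⟩ := hasGlobalMinimalModel_rat_holds (W.quadraticTwist (NumberField.discr K : ℚ))
  haveI : (Cd • W.quadraticTwist (NumberField.discr K : ℚ)).IsGloballyMinimal := hCd
  set Wd : WeierstrassCurve ℚ := Cd • W.quadraticTwist (NumberField.discr K : ℚ) with hWd_def
  have hWd : Cd • W.quadraticTwist (NumberField.discr K : ℚ) = Wd := rfl
  -- the twist has analytic rank `0` and `E^{d}[p]` irreducible
  have hirrd : Wd.HasIrreducibleModPGaloisRep p :=
    hasIrreducibleModPGaloisRep_twist_model W p K h2 hirr Cd hWd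
  have hLt' : (W.quadraticTwist (NumberField.discr K : ℚ)).entireLFunction = Wd.entireLFunction := by
    rw [← hWd, entireLFunction_smul]
  have hLd1 : Wd.entireLFunction 1 ≠ 0 := by rw [← hLt']; exact hLt
  have hrd : Wd.analyticRank = 0 := (Wd.analyticRank_eq_zero_iff_holds (hmod Wd)).2 hLd1
  -- the twist is an X11a pair at `p`: `p` inert (in `T`) or split (off `T`)
  have hXd : ClassX11a Wd p := by
    by_cases hpT : p ∈ T
    · obtain ⟨hnp, hdp⟩ := hinert p hpT
      have hJp : jacobiSym (NumberField.discr K) p = -1 :=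
        jacobiSym_discr_eq_neg_one_of_ncard_ne_two h2 hp hp2 (by rw [hnp]; decide) hdp
      exact classX11a_twist_of_not_ram_inertSet W p hX hnram K h2 hJp T hTin
        (fun ℓ _ hg hℓT ↦ hsplit ℓ hg hℓT) Cd hWd hrd
    · have hmultd : Mult Wd p := by
        have hsq : IsSquare (algebraMap ℚ ℚ_[p] (NumberField.discr K : ℚ)) :=
          hsplit p (WeierstrassCurve.HasMultiplicativeReduction.not_hasGoodReduction (R := ℤ_[p]) hmult) hpT
        have h' : (Cd • W.quadraticTwist (NumberField.discr K : ℚ)).HasMultiplicativeReductionAtPrime p := by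
          rw [hasMultiplicativeReductionAtPrime_smul_iff]
          exact (hasMultiplicativeReductionAtPrime_quadraticTwist_iff W hD0 hsq).mpr hmult
        exact h'
      exact ⟨hrd, hp2, hmultd, hirrd,
        not_ram_twist_of_inertSet W p K T hTin (fun ℓ _ hg hℓT ↦ hsplit ℓ hg hℓT) hnram Cd hWd⟩
  -- THE ONE NEW LINE: the twist's mod-`p` representation is NOT surjective either (`E^{(d)}[p] ≅ E[p] ⊗ χ_d`)
  have hnsd : ¬ Surj Wd p := fun h ↦ hns ((Additive.surj_iff_of_model_twist W p hD0 ⟨Cd, hWd⟩).1 h)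
  -- the X11a lower half at the (non-surjective) twist, in print shape
  obtain ⟨qS, hqS, hvqS⟩ :=
    AdditivePotMult.exists_printShape_lower_of_missingLowerBoundAt_rankZero (p := p) Wd hGZK hrd hirrd
      (hX11a Wd hXd hnsd)
  exact ⟨K, inferInstance, inferInstance, Wd, inferInstance, hCd, Cd, hK, hdisc, hinert, hsplitN, hLt, hWd,
    qS, hqS, hvqS⟩

/-- **The same supply from the SHAPE of 19064's registered `stub_lowerNonSurjDeep`** (the X11a lower half at NON-surjective curves whose
`#Ш_an` is NOT a `p`-adic unit): §1 + the previous theorem. Bookkeeping; CONDITIONAL.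
[cite: FriedbergHoffstein1995, Thm. B] [cite: Miller2011LMS, Def. 1.1] -/
theorem fhTwinLowerSupplyAt_of_friedbergHoffstein_of_lowerNonSurjDeep
    (hGZK : rank_eq_analyticRank_of_analyticRank_le_one) (hmod : hasEntireLFunction_rat)
    (hnf : exists_isNewformOf)
    (hFH : friedbergHoffstein_exists_twist_ne_zero_inertAt)
    (W : WeierstrassCurve ℚ) [W.IsElliptic] [W.IsGloballyMinimal] (p : ℕ) [Fact p.Prime]
    (hX : ClassX11b W p) (hns : ¬ Surj W p) (hnram : ¬ Ram W p)
    (hX11a : ∀ (Wd : WeierstrassCurve ℚ) [Wd.IsElliptic] [Wd.IsGloballyMinimal],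
      ClassX11a Wd p → ¬ Surj Wd p → ¬ X11a.ShaAnUnit Wd p → Typed.MissingLowerBoundAt Wd p) :
    FHTwinLowerSupplyAt W p :=
  fhTwinLowerSupplyAt_of_friedbergHoffstein_of_lowerNonSurj hGZK hmod hnf hFH W p hX hns hnram
    (fun Wd _ _ hXa hnsd ↦ lowerNonSurj_of_lowerNonSurjDeep hX11a Wd hXa hnsd)

/-- **Class-level corner form (binders of crux 19065).** On every (T4′) corner pair — `ClassX11b W p`, `¬ Surj W p`, no (ram) prime — the
twin-lower supply `FHTwinLowerSupplyAt W p` follows from Friedberg–Hoffstein and the STATEMENT of 19064's registered `stub_lowerNonSurjDeep`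
(quantified over the prime as on that line). This is the `hTLc` binder of glue #8. Bookkeeping; CONDITIONAL; 19065 ∕ 19064 OPEN.
[cite: FriedbergHoffstein1995, Thm. B] [cite: Miller2011LMS, Def. 1.1] -/
theorem NonSurjCorner.fhTwinLowerSupplyAt_of_lowerNonSurjDeep
    (hGZK : rank_eq_analyticRank_of_analyticRank_le_one) (hmod : hasEntireLFunction_rat)
    (hnf : exists_isNewformOf)
    (hFH : friedbergHoffstein_exists_twist_ne_zero_inertAt)
    (h₄ns : ∀ (Wd : WeierstrassCurve ℚ) [Wd.IsElliptic] [Wd.IsGloballyMinimal] (p : ℕ) [Fact p.Prime],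
      ClassX11a Wd p → ¬ Surj Wd p → ¬ X11a.ShaAnUnit Wd p → Typed.MissingLowerBoundAt Wd p)
    (W : WeierstrassCurve ℚ) [W.IsElliptic] [W.IsGloballyMinimal] (p : ℕ) [Fact p.Prime]
    (hX : ClassX11b W p) (hns : ¬ Surj W p) (hnram : ¬ Ram W p) :
    FHTwinLowerSupplyAt W p :=
  fhTwinLowerSupplyAt_of_friedbergHoffstein_of_lowerNonSurjDeep hGZK hmod hnf hFH W p hX hns hnram
    (fun Wd _ _ hXa hnsd hu ↦ h₄ns Wd p hXa hnsd hu)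

/-! ### §3. (appended, g16) The supply from the X11a lower half at the corner's NON-SURJECTIVE LEAF TWINS only

The twist `Wd = Cd • E^{(d_K)}` at a Friedberg–Hoffstein frame of a corner pair has, besides `¬ Surj Wd p`, ALSO `p ∣ ord_p Δ_min(Wd)`:
`ord_p Δ_min` is invariant under the twist by `d_K` because `p ∤ d_K` — `p` inert (`(d_K/p) = −1`,
`X11b.padicValInt_minimalDiscriminantInt_twist_eq_of_jacobiSym`) or split (`d_K ∈ ℚ_p^{×2}`, `X11b.padicValInt_minimalDiscriminantInt_twist_eq`).
So the X11a lower half is consumed only at the NON-SURJECTIVE X11a LEAF TWINS `ClassX11a Wd p ∧ ¬ Surj Wd p ∧ p ∣ ord_p Δ_min(Wd)` — the SAME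
population on which item 19948 `NonSurjCornerTwinMuAn` asks analytic `μ = 0`, and exactly the binder `hLtw` of the X₀(N) MAX road
(`missingUpperBoundAt_corner_of_jetchevDivisibility_of_twinLeafLower`, this seat g3). -/

/-- **`FHTwinLowerSupplyAt W p` ⟸ Friedberg–Hoffstein ∧ the X11a lower half at the NON-SURJECTIVE LEAF TWINS, on a corner pair**
(`ClassX11b W p`, `¬ Surj W p`, `p ∣ ord_p Δ_min(W)`, no (ram) prime). §2's proof VERBATIM plus: `p ∣ ord_p Δ_min(Wd)` for the twist
(`ord_p Δ_min` is a twist invariant at `p ∤ d_K`: inert case `padicValInt_minimalDiscriminantInt_twist_eq_of_jacobiSym`, split case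
`padicValInt_minimalDiscriminantInt_twist_eq`). Bookkeeping; CONDITIONAL on `hGZK`, `hmod`, `hnf`, `hFH`, `hX11a`.
-- adapted from Summits/BirchSwinnertonDyer/BirchSwinnertonDyer/Theorems/ClassRecordThreeCornerAtThreeTwinLowerSupplyDefs.lean
[cite: FriedbergHoffstein1995, Thm. B] [cite: SilvermanAEC2009, VII.1 Prop. 1.3(b) and X.5 Cor. 5.4] [cite: Skinner2016PacificMC, Thm. C (shape)]
[cite: Miller2011LMS, Def. 1.1] -/
theorem fhTwinLowerSupplyAt_of_friedbergHoffstein_of_lowerNonSurjLeaf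
    (hGZK : rank_eq_analyticRank_of_analyticRank_le_one) (hmod : hasEntireLFunction_rat)
    (hnf : exists_isNewformOf)
    (hFH : friedbergHoffstein_exists_twist_ne_zero_inertAt)
    (W : WeierstrassCurve ℚ) [W.IsElliptic] [W.IsGloballyMinimal] (p : ℕ) [Fact p.Prime]
    (hX : ClassX11b W p) (hns : ¬ Surj W p) (hv : p ∣ padicValInt p W.minimalDiscriminantInt) (hnram : ¬ Ram W p)
    (hX11a : ∀ (Wd : WeierstrassCurve ℚ) [Wd.IsElliptic] [Wd.IsGloballyMinimal],
      ClassX11a Wd p → ¬ Surj Wd p → p ∣ padicValInt p Wd.minimalDiscriminantInt → Typed.MissingLowerBoundAt Wd p) :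
    FHTwinLowerSupplyAt W p := by
  intro T hTmult hTeven
  have hp : p.Prime := Fact.out
  obtain ⟨hr, hp2, hmult, hirr⟩ := id hX
  -- the sign of the functional equation is `−1` (modularity, `r_an = 1`)
  have hw : W.rootNumber = -1 := by
    rw [WeierstrassCurve.rootNumber_eq_neg_one_pow_analyticRank_of_exists_isNewformOf hnf W, hr]
    norm_num
  -- the Friedberg–Hoffstein field, `T` inert, every other bad prime split, `|d_K| > 4`
  obtain ⟨K, _, _, hK, hdisc, hinert, hsplitN, hLt⟩ := hFH W hw T hTmult hTeven 4
  have h2 := hK.1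
  have hTin : ∀ ℓ ∈ T, ∃ _ : Fact ℓ.Prime, Mult W ℓ ∧
      ((ℓ ≠ 2 ∧ jacobiSym (NumberField.discr K) ℓ = -1) ∨ (ℓ = 2 ∧ NumberField.discr K % 8 = 5)) := by
    intro ℓ hℓ
    obtain ⟨hℓF, hm⟩ := hTmult ℓ hℓ
    obtain ⟨hn, hd⟩ := hinert ℓ hℓ
    refine ⟨hℓF, hm, ?_⟩
    have hn' : ((Ideal.span {(ℓ : ℤ)}).primesOver (𝓞 K)).ncard ≠ 2 := by rw [hn]; decide
    by_cases hℓ2 : ℓ = 2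
    · subst hℓ2
      have hn2 : ((Ideal.span {(2 : ℤ)}).primesOver (𝓞 K)).ncard ≠ 2 := by
        simpa only [Nat.cast_ofNat] using hn'
      have hd2 : ¬ (2 : ℤ) ∣ NumberField.discr K := by simpa only [Nat.cast_ofNat] using hd
      exact Or.inr ⟨rfl, discr_emod_eight_eq_five_of_ncard_ne_two h2 hn2 hd2⟩
    · exact Or.inl ⟨hℓ2, jacobiSym_discr_eq_neg_one_of_ncard_ne_two h2 hℓF.out hℓ2 hn' hd⟩
  have hsplit : ∀ (ℓ : ℕ) [Fact ℓ.Prime], ¬ W.HasGoodReductionAtPrime ℓ → ℓ ∉ T →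
      IsSquare (algebraMap ℚ ℚ_[ℓ] (NumberField.discr K : ℚ)) := by
    intro ℓ hℓF hg hℓT
    have hℓN : ℓ ∣ W.conductorNorm ℤ := (W.dvd_conductorNorm_iff_not_hasGoodReductionAtPrime ℓ).mpr hg
    exact isSquare_discr_padic_of_ncard_eq_two h2 ℓ (hsplitN ℓ hℓF.out hℓN hℓT)
  -- a globally minimal model of the twist
  have hD0 : (NumberField.discr K : ℚ) ≠ 0 := by exact_mod_cast NumberField.discr_ne_zero K
  haveI hEt : (W.quadraticTwist (NumberField.discr K : ℚ)).IsElliptic :=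
    W.isElliptic_quadraticTwist hD0
  obtain ⟨Cd, hCd⟩ := hasGlobalMinimalModel_rat_holds (W.quadraticTwist (NumberField.discr K : ℚ))
  haveI : (Cd • W.quadraticTwist (NumberField.discr K : ℚ)).IsGloballyMinimal := hCd
  set Wd : WeierstrassCurve ℚ := Cd • W.quadraticTwist (NumberField.discr K : ℚ) with hWd_def
  have hWd : Cd • W.quadraticTwist (NumberField.discr K : ℚ) = Wd := rfl
  -- the twist has analytic rank `0` and `E^{d}[p]` irreducible
  have hirrd : Wd.HasIrreducibleModPGaloisRep p :=
    hasIrreducibleModPGaloisRep_twist_model W p K h2 hirr Cd hWd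
  have hLt' : (W.quadraticTwist (NumberField.discr K : ℚ)).entireLFunction = Wd.entireLFunction := by
    rw [← hWd, entireLFunction_smul]
  have hLd1 : Wd.entireLFunction 1 ≠ 0 := by rw [← hLt']; exact hLt
  have hrd : Wd.analyticRank = 0 := (Wd.analyticRank_eq_zero_iff_holds (hmod Wd)).2 hLd1
  -- the twist is an X11a pair at `p` with `p ∣ ord_p Δ_min(Wd)`: `p` inert (in `T`) or split (off `T`)
  have hXdv : ClassX11a Wd p ∧ p ∣ padicValInt p Wd.minimalDiscriminantInt := by
    by_cases hpT : p ∈ T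
    · obtain ⟨hnp, hdp⟩ := hinert p hpT
      have hJp : jacobiSym (NumberField.discr K) p = -1 :=
        jacobiSym_discr_eq_neg_one_of_ncard_ne_two h2 hp hp2 (by rw [hnp]; decide) hdp
      refine ⟨classX11a_twist_of_not_ram_inertSet W p hX hnram K h2 hJp T hTin
        (fun ℓ _ hg hℓT ↦ hsplit ℓ hg hℓT) Cd hWd hrd, ?_⟩
      rw [padicValInt_minimalDiscriminantInt_twist_eq_of_jacobiSym W K Cd hWd p hp2 hJp]
      exact hv
    · have hsq : IsSquare (algebraMap ℚ ℚ_[p] (NumberField.discr K : ℚ)) :=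
        hsplit p (WeierstrassCurve.HasMultiplicativeReduction.not_hasGoodReduction (R := ℤ_[p]) hmult) hpT
      have hmultd : Mult Wd p := by
        have h' : (Cd • W.quadraticTwist (NumberField.discr K : ℚ)).HasMultiplicativeReductionAtPrime p := by
          rw [hasMultiplicativeReductionAtPrime_smul_iff]
          exact (hasMultiplicativeReductionAtPrime_quadraticTwist_iff W hD0 hsq).mpr hmult
        exact h'
      refine ⟨⟨hrd, hp2, hmultd, hirrd,
        not_ram_twist_of_inertSet W p K T hTin (fun ℓ _ hg hℓT ↦ hsplit ℓ hg hℓT) hnram Cd hWd⟩, ?_⟩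
      rw [padicValInt_minimalDiscriminantInt_twist_eq W p hD0 hsq Cd hWd]
      exact hv
  -- the twist's mod-`p` representation is NOT surjective either (`E^{(d)}[p] ≅ E[p] ⊗ χ_d`)
  have hnsd : ¬ Surj Wd p := fun h ↦ hns ((Additive.surj_iff_of_model_twist W p hD0 ⟨Cd, hWd⟩).1 h)
  -- the X11a lower half at the (non-surjective, leaf) twist, in print shape
  obtain ⟨qS, hqS, hvqS⟩ :=
    AdditivePotMult.exists_printShape_lower_of_missingLowerBoundAt_rankZero (p := p) Wd hGZK hrd hirrd
      (hX11a Wd hXdv.1 hnsd hXdv.2)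
  exact ⟨K, inferInstance, inferInstance, Wd, inferInstance, hCd, Cd, hK, hdisc, hinert, hsplitN, hLt, hWd,
    qS, hqS, hvqS⟩

/-- **Class-level corner form, LEAF and DEEP (binders of crux 19065; slot-4 shape of `Lines/hybrid.lean` r6).** On every (T4′) corner
pair — `ClassX11b W p`, `¬ Surj W p`, `p ∈ {5, 7}`, `p ∣ ord_p Δ_min(W)`, no (ram) prime — the twin-lower supply `FHTwinLowerSupplyAt W p`
follows from Friedberg–Hoffstein and **the X11a lower half at the corner's NON-SURJECTIVE LEAF TWINS whose `#Ш_an` is not a `p`-adic unit**: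
`∀ Wd p, ClassX11a Wd p → ¬ Surj Wd p → (p = 5 ∨ p = 7) → p ∣ ord_p Δ_min(Wd) → ¬ X11a.ShaAnUnit Wd p → MissingLowerBoundAt Wd p`
(= 19064's registered `stub_lowerNonSurjDeep` restricted to the twins named by item 19948; the unit case is trivial,
`lowerNonSurj_of_lowerNonSurjDeep`'s argument). This is the `hTLc` producer of glue #8. Bookkeeping; CONDITIONAL; 19065 ∕ 19064 OPEN.
[cite: FriedbergHoffstein1995, Thm. B] [cite: Miller2011LMS, Def. 1.1] -/
theorem NonSurjCorner.fhTwinLowerSupplyAt_of_lowerLeafTwinDeep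
    (hGZK : rank_eq_analyticRank_of_analyticRank_le_one) (hmod : hasEntireLFunction_rat)
    (hnf : exists_isNewformOf)
    (hFH : friedbergHoffstein_exists_twist_ne_zero_inertAt)
    (h₄ℓ : ∀ (Wd : WeierstrassCurve ℚ) [Wd.IsElliptic] [Wd.IsGloballyMinimal] (p : ℕ) [Fact p.Prime],
      ClassX11a Wd p → ¬ Surj Wd p → (p = 5 ∨ p = 7) → p ∣ padicValInt p Wd.minimalDiscriminantInt →
      ¬ X11a.ShaAnUnit Wd p → Typed.MissingLowerBoundAt Wd p)
    (W : WeierstrassCurve ℚ) [W.IsElliptic] [W.IsGloballyMinimal] (p : ℕ) [Fact p.Prime]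
    (hX : ClassX11b W p) (hns : ¬ Surj W p) (h57 : p = 5 ∨ p = 7) (hv : p ∣ padicValInt p W.minimalDiscriminantInt)
    (hnram : ¬ Ram W p) :
    FHTwinLowerSupplyAt W p :=
  fhTwinLowerSupplyAt_of_friedbergHoffstein_of_lowerNonSurjLeaf hGZK hmod hnf hFH W p hX hns hv hnram
    (fun Wd _ _ hXa hnsd hvd ↦ by
      by_cases hu : X11a.ShaAnUnit Wd p
      · obtain ⟨q, hq, hvq⟩ := hu
        exact ⟨q, hq, by rw [hvq]; exact_mod_cast Nat.zero_le _⟩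
      · exact h₄ℓ Wd p hXa hnsd h57 hvd hu)

end Summit.BirchSwinnertonDyer.BirchSwinnertonDyer.Theorems

end
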